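import Mathlib
import Literature.Analysis.FluidPDE.PlanarCircleWirtinger
import Literature.Analysis.FluidPDE.CylindricalCutoff
import HarnessLib

/-!
# Census row S7 (bounded steady flows in the periodic slab, case (d)): slab tools —
# translation invariance per period and the sharp Wirtinger inequality in `x₃`

Support file for the scenario census of `NavierStokesRegularity` (cell `pub/ns-census`, row S7 =
Bang–Gui–Wang–Xie 2025, Thm 1.4 (d): a bounded smooth steady Navier–Stokes flow on `ℝ² × 𝕋_L` with
`sup ‖U‖ < 2πν/L` is constant; tree FACT
`Literature.Analysis.FluidPDE.BangGuiWangXie2025_periodicSlab_liouville`, second conjunct). The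
printed proof (arXiv:2205.13259, §5 Step 4) rests on the Wirtinger inequality in the periodic
variable, `‖∂₃u‖_{L²(period)} ≤ (L/2π) ‖∂₃²u‖_{L²(period)}` ("since `∫_0^1 ∂_{x_3}u dx_3 = 0`, by
virtue of Poincaré inequality"), applied under `z`-independent horizontal weights. This file proves
that inequality in the tree's slab vocabulary (`Literature.Analysis.FluidPDE.zSlab L 0 = {0 ≤ x₂ < L}`,
`Literature.Analysis.FluidPDE.IsAxiallyPeriodic`), with the SHARP constant `(2π/L)²` (it is the
constant that produces the printed threshold `2π`):

* `setLIntegral_zSlab_comp_add_smul_eZ` — the integral over one period slab of an axially periodic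
  density is invariant under ALL axial translations (not only integer multiples of the period);
  proof through the smooth partition-of-unity window of `PeriodicWindowIntegral`
  (`∫ Q ω² = ∫_{slab} Q`, translation invariance of Lebesgue measure, `∑ₖ ω(z − s + kL)² = 1`).
* `vertical_wirtinger` — for `V ∈ C²` axially `L`-periodic and every base point `x`,
  `(2π/L)² ∫₀ᴸ ‖∂₃V(x + s e₃)‖² ds ≤ ∫₀ᴸ ‖∂₃∂₃V(x + s e₃)‖² ds` (coordinatewise
  `Literature.Analysis.FluidPDE.wirtinger_interval_real`; `∂₃V` has zero mean over a period).
* `slab_wirtinger` — for a measurable, bounded, `z`-independent weight `g ≥ 0` vanishing off a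
  cylinder, `(2π/L)² ∫_{slab} g ‖∂₃V‖² ≤ ∫_{slab} g ‖∂₃∂₃V‖²` (vertical averaging + Tonelli; no
  product decomposition of `ℝ³` is used).

No summit statement and no census row is proved in this file.

## References

* J. Bang, C. Gui, Y. Wang, C. Xie, *Liouville-type theorems for steady solutions to the
  Navier–Stokes system in a slab*, J. Fluid Mech. 1005 (2025) A6 = arXiv:2205.13259, §5 Step 4
  (proof of Thm 1.4 (d): the Wirtinger inequality with constant `1/(2π)`). [BangGuiWangXie2025]
* G. H. Hardy, J. E. Littlewood, G. Pólya, *Inequalities*, §7.7 Thm 258 (Wirtinger).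
-/

-- the summit and its single problem share the name (D-0017 nested layout)
set_option linter.dupNamespace false

noncomputable section

open MeasureTheory Set Function Filter
open scoped Topology ENNReal NNReal InnerProductSpace

namespace Summit.NavierStokesRegularity.NavierStokesRegularity.Theorems.ScenarioCensus.PeriodicSlab

open Literature.Analysis Literature.Analysis.FluidPDE

/-! ### Coordinates along the axis -/

/-- `(x + s e₃)₂ = x₂ + s`. -/
theorem apply_two_add_smul_eZ (x : EuclideanSpace ℝ (Fin 3)) (s : ℝ) :
    (x + s • eZ) 2 = x 2 + s := by
  simp [eZ]

/-- An axially `L`-periodic function is periodic along `e₃` with period `L` in the additive form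
`Q (x + L • eZ) = Q x`. -/
theorem isAxiallyPeriodic_add_smul_eZ {α : Sort*} {L : ℝ} {Q : EuclideanSpace ℝ (Fin 3) → α}
    (hQ : IsAxiallyPeriodic L Q) (x : EuclideanSpace ℝ (Fin 3)) : Q (x + L • eZ) = Q x :=
  hQ x

/-- Axial translates of an axially periodic function are axially periodic. -/
theorem isAxiallyPeriodic_comp_add_smul_eZ {α : Sort*} {L : ℝ} {Q : EuclideanSpace ℝ (Fin 3) → α}
    (hQ : IsAxiallyPeriodic L Q) (s : ℝ) : IsAxiallyPeriodic L fun x => Q (x + s • eZ) := by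
  intro x
  show Q (x + L • EuclideanSpace.single 2 1 + s • eZ) = Q (x + s • eZ)
  rw [add_right_comm]
  exact hQ (x + s • eZ)

/-! ### Translation invariance of slab integrals of periodic densities -/

/-- **All axial translates have the same integral over one period.** For a measurable axially
`L`-periodic density `Q ≥ 0` (`L > 0`) and every `s : ℝ`,
`∫⁻_{zSlab L 0} Q(x + s e₃) dx = ∫⁻_{zSlab L 0} Q`. -/
theorem setLIntegral_zSlab_comp_add_smul_eZ {L : ℝ} (hL : 0 < L)
    {Q : EuclideanSpace ℝ (Fin 3) → ℝ≥0∞} (hQm : Measurable Q) (hQ : IsAxiallyPeriodic L Q)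
    (s : ℝ) : ∫⁻ x in zSlab L 0, Q (x + s • eZ) = ∫⁻ x in zSlab L 0, Q x := by
  have hQs : IsAxiallyPeriodic L (fun x => Q (x + s • eZ)) := isAxiallyPeriodic_comp_add_smul_eZ hQ s
  have hQsm : Measurable (fun x => Q (x + s • eZ)) := hQm.comp (measurable_id.add_const _)
  rw [← lintegral_mul_periodicWindow_sq hL hQsm.aemeasurable hQs]
  -- substitute `x ↦ x - s e₃` (translation invariance of Lebesgue measure)
  have hW : Measurable fun z : ℝ => ENNReal.ofReal (periodicWindow L (z - s) ^ 2) :=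
    ENNReal.measurable_ofReal.comp
      (((contDiff_periodicWindow L (n := 0)).continuous.comp (continuous_id.sub continuous_const)).pow 2).measurable
  have h1 : ∫⁻ x, Q (x + s • eZ) * ENNReal.ofReal (periodicWindow L (x 2) ^ 2) =
      ∫⁻ x, Q x * ENNReal.ofReal (periodicWindow L (x 2 - s) ^ 2) := by
    rw [← lintegral_add_right_eq_self
      (fun x : EuclideanSpace ℝ (Fin 3) => Q x * ENNReal.ofReal (periodicWindow L (x 2 - s) ^ 2))
      (s • eZ)]
    refine lintegral_congr fun x => ?_
    rw [apply_two_add_smul_eZ, add_sub_cancel_right]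
  rw [h1]
  have h2 := lintegral_mul_comp_apply_two_eq_const_mul hL hQm.aemeasurable hQ hW (c := 1)
    (fun z => by
      have hs : Summable fun k : ℤ => periodicWindow L ((z - s) + (k : ℝ) * L) ^ 2 := by
        by_contra hns
        have := tsum_eq_zero_of_not_summable hns
        rw [tsum_periodicWindow_sq hL (z - s)] at this
        exact one_ne_zero this
      have e : (fun k : ℤ => ENNReal.ofReal (periodicWindow L (z + (k : ℝ) * L - s) ^ 2)) =
          fun k : ℤ => ENNReal.ofReal (periodicWindow L ((z - s) + (k : ℝ) * L) ^ 2) := by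
        funext k; ring_nf
      rw [e, ← ENNReal.ofReal_tsum_of_nonneg (fun k => sq_nonneg _) hs,
        tsum_periodicWindow_sq hL (z - s), ENNReal.ofReal_one])
  rw [h2, one_mul]

/-! ### The vertical Wirtinger inequality -/

/-- The derivative of an axially `L`-periodic `C¹` field is axially `L`-periodic. -/
theorem isAxiallyPeriodic_fderiv {F : Type*} [NormedAddCommGroup F] [NormedSpace ℝ F] {L : ℝ}
    {V : EuclideanSpace ℝ (Fin 3) → F} (hper : IsAxiallyPeriodic L V) :
    IsAxiallyPeriodic L (fderiv ℝ V) := by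
  intro x
  have hfun : (fun y => V (y + L • EuclideanSpace.single 2 (1 : ℝ))) = V := funext fun y => hper y
  have h := fderiv_comp_add_right (𝕜 := ℝ) (f := V) (x := x) (L • EuclideanSpace.single 2 (1 : ℝ))
  rw [hfun] at h
  exact h.symm

/-- Derivative along the axis: `d/ds V(x + s e₃) = DV(x + s e₃) e₃`. -/
theorem hasDerivAt_comp_add_smul_eZ {F : Type*} [NormedAddCommGroup F] [NormedSpace ℝ F]
    {V : EuclideanSpace ℝ (Fin 3) → F} (hV : Differentiable ℝ V) (x : EuclideanSpace ℝ (Fin 3))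
    (s : ℝ) : HasDerivAt (fun σ : ℝ => V (x + σ • eZ)) ((fderiv ℝ V (x + s • eZ)) eZ) s := by
  have hℓ : HasDerivAt (fun σ : ℝ => x + σ • eZ) eZ s := by
    have h := ((hasDerivAt_id s).smul_const (eZ : EuclideanSpace ℝ (Fin 3))).const_add x
    simpa using h
  exact (hV (x + s • eZ)).hasFDerivAt.comp_hasDerivAt s hℓ

/-- **Vertical Wirtinger inequality** (sharp constant): for `V ∈ C²` axially `L`-periodic
(`L > 0`) and every base point `x`,
`(2π/L)² ∫₀ᴸ ‖∂₃V(x + s e₃)‖² ds ≤ ∫₀ᴸ ‖∂₃∂₃V(x + s e₃)‖² ds`: each coordinate of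
`s ↦ ∂₃V(x + s e₃)` is `L`-periodic with zero mean (it is the derivative of the periodic
`s ↦ V(x + s e₃)`), so `Literature.Analysis.FluidPDE.wirtinger_interval_real` applies. -/
theorem vertical_wirtinger {L : ℝ} (hL : 0 < L)
    {V : EuclideanSpace ℝ (Fin 3) → EuclideanSpace ℝ (Fin 3)} (hV : ContDiff ℝ 2 V)
    (hper : IsAxiallyPeriodic L V) (x : EuclideanSpace ℝ (Fin 3)) :
    (2 * Real.pi / L) ^ 2 * ∫ s in (0 : ℝ)..L, ‖fderiv ℝ V (x + s • eZ) eZ‖ ^ 2 ≤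
      ∫ s in (0 : ℝ)..L, ‖fderiv ℝ (fun y => fderiv ℝ V y eZ) (x + s • eZ) eZ‖ ^ 2 := by
  set w : EuclideanSpace ℝ (Fin 3) → EuclideanSpace ℝ (Fin 3) := fun y => fderiv ℝ V y eZ with hw
  have hV1 : ContDiff ℝ 1 V := hV.of_le one_le_two
  have hw1 : ContDiff ℝ 1 w := (hV.fderiv_right (m := 1) le_rfl).clm_apply contDiff_const
  have hVd : Differentiable ℝ V := hV1.differentiable one_ne_zero
  have hwd : Differentiable ℝ w := hw1.differentiable one_ne_zero
  have hwc : Continuous w := hw1.continuous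
  have hdwc : Continuous (fderiv ℝ w) := hw1.continuous_fderiv one_ne_zero
  have hwper : IsAxiallyPeriodic L w := fun y => by
    show fderiv ℝ V (y + L • EuclideanSpace.single 2 1) eZ = fderiv ℝ V y eZ
    rw [isAxiallyPeriodic_fderiv hper y]
  -- coordinates along the vertical line through `x`
  set ℓ : ℝ → EuclideanSpace ℝ (Fin 3) := fun s => x + s • eZ with hℓ
  have hℓc : Continuous ℓ := continuous_const.add (continuous_id.smul continuous_const)
  set c : Fin 3 → ℝ → ℝ := fun i s => (w (ℓ s)) i with hc
  set c' : Fin 3 → ℝ → ℝ := fun i s => (fderiv ℝ w (ℓ s) eZ) i with hc'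
  have hproj : ∀ i : Fin 3, ∀ v : EuclideanSpace ℝ (Fin 3),
      (EuclideanSpace.proj i : EuclideanSpace ℝ (Fin 3) →L[ℝ] ℝ) v = v i := fun i v => rfl
  have hc_deriv : ∀ i s, HasDerivAt (c i) (c' i s) s := by
    intro i s
    have h := hasDerivAt_comp_add_smul_eZ hwd x s
    have h2 := ((EuclideanSpace.proj i : EuclideanSpace ℝ (Fin 3) →L[ℝ] ℝ).hasFDerivAt).comp_hasDerivAt
      s h
    simpa [hc, hc', hℓ, hproj, Function.comp_def] using h2
  have hb_deriv : ∀ i s, HasDerivAt (fun σ => (V (ℓ σ)) i) (c i s) s := by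
    intro i s
    have h := hasDerivAt_comp_add_smul_eZ hVd x s
    have h2 := ((EuclideanSpace.proj i : EuclideanSpace ℝ (Fin 3) →L[ℝ] ℝ).hasFDerivAt).comp_hasDerivAt
      s h
    simpa [hc, hℓ, hw, hproj, Function.comp_def] using h2
  have hc_cont : ∀ i, Continuous (c i) := fun i =>
    (continuous_apply i).comp ((PiLp.continuous_ofLp 2 _).comp (hwc.comp hℓc))
  have hc'_cont : ∀ i, Continuous (c' i) := fun i =>
    (continuous_apply i).comp ((PiLp.continuous_ofLp 2 _).comp
      ((hdwc.comp hℓc).clm_apply continuous_const))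
  -- periodicity and zero mean
  have hℓL : ℓ L = x + L • eZ := rfl
  have hℓ0 : ℓ 0 = x := by simp [hℓ]
  have hc_per : ∀ i, c i L = c i 0 := fun i => by
    simp only [hc, hℓL, hℓ0]
    rw [isAxiallyPeriodic_add_smul_eZ hwper x]
  have hc_mean : ∀ i, ∫ s in (0 : ℝ)..L, c i s = 0 := fun i => by
    rw [intervalIntegral.integral_eq_sub_of_hasDerivAt (fun s _ => hb_deriv i s)
      ((hc_cont i).intervalIntegrable _ _), hℓL, hℓ0, isAxiallyPeriodic_add_smul_eZ hper x, sub_self]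
  -- Wirtinger, coordinate by coordinate
  have hW : ∀ i, (2 * Real.pi / L) ^ 2 * ∫ s in (0 : ℝ)..L, c i s ^ 2 ≤
      ∫ s in (0 : ℝ)..L, c' i s ^ 2 := fun i => by
    have h := wirtinger_interval_real hL (hc_deriv i) (hc'_cont i) (hc_per i) (hc_mean i)
    rwa [sub_zero] at h
  -- sum over coordinates
  have hn : ∀ v : EuclideanSpace ℝ (Fin 3), ‖v‖ ^ 2 = ∑ i, v i ^ 2 := fun v =>
    EuclideanSpace.real_norm_sq_eq v
  have e1 : ∫ s in (0 : ℝ)..L, ‖fderiv ℝ V (x + s • eZ) eZ‖ ^ 2 =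
      ∑ i, ∫ s in (0 : ℝ)..L, c i s ^ 2 := by
    rw [← intervalIntegral.integral_finsetSum (f := fun i σ => c i σ ^ 2) fun i _ =>
      ((hc_cont i).pow 2).intervalIntegrable _ _]
    refine intervalIntegral.integral_congr fun s _ => ?_
    simpa [hc, hℓ, hw] using hn (w (ℓ s))
  have e2 : ∫ s in (0 : ℝ)..L, ‖fderiv ℝ (fun y => fderiv ℝ V y eZ) (x + s • eZ) eZ‖ ^ 2 =
      ∑ i, ∫ s in (0 : ℝ)..L, c' i s ^ 2 := by
    rw [← intervalIntegral.integral_finsetSum (f := fun i σ => c' i σ ^ 2) fun i _ =>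
      ((hc'_cont i).pow 2).intervalIntegrable _ _]
    refine intervalIntegral.integral_congr fun s _ => ?_
    simpa [hc', hℓ, hw] using hn (fderiv ℝ w (ℓ s) eZ)
  rw [e1, e2, Finset.mul_sum]
  exact Finset.sum_le_sum fun i _ => hW i


/-! ### The Wirtinger inequality on one period slab under a `z`-independent weight -/

/-- A point of the period slab `zSlab L 0` (`L > 0`) inside the cylinder `{r < ρ}` lies in the
closed ball of radius `|ρ| + L`. -/
theorem norm_le_of_mem_zSlab_of_cylRadius_lt {L ρ : ℝ} (hL : 0 < L) {x : EuclideanSpace ℝ (Fin 3)}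
    (hx : x ∈ zSlab L 0) (hr : cylRadius x < ρ) : ‖x‖ ≤ |ρ| + L := by
  rw [mem_zSlab] at hx
  simp only [Int.cast_zero, zero_mul, zero_add, one_mul] at hx
  have h1 := norm_le_cylRadius_add_abs_apply_two x
  have h2 : |x 2| ≤ L := by
    rw [abs_le]; constructor <;> linarith [hx.1, hx.2]
  linarith [le_abs_self ρ]

/-- **Integrability on a period slab** of a measurable function vanishing off a cylinder and
bounded on the ball that contains the slab's part of the cylinder. -/
theorem integrableOn_zSlab_of_bound {L : ℝ} (hL : 0 < L) {F : EuclideanSpace ℝ (Fin 3) → ℝ}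
    (hFm : AEStronglyMeasurable F volume) {ρ : ℝ} (hF0 : ∀ x, ρ ≤ cylRadius x → F x = 0)
    {B : ℝ} (hFB : ∀ x, ‖x‖ ≤ |ρ| + L → ‖F x‖ ≤ B) : IntegrableOn F (zSlab L 0) volume := by
  set K : Set (EuclideanSpace ℝ (Fin 3)) := Metric.closedBall 0 (|ρ| + L) with hK
  have hKfin : volume K ≠ ⊤ := (isCompact_closedBall _ _).measure_lt_top.ne
  have hIK : IntegrableOn F K volume := by
    refine Measure.integrableOn_of_bounded hKfin hFm (M := B) ?_
    rw [ae_restrict_iff' Metric.isClosed_closedBall.measurableSet]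
    exact Eventually.of_forall fun x hx => hFB x (mem_closedBall_zero_iff.1 hx)
  refine hIK.of_forall_sdiff_eq_zero (measurableSet_zSlab L 0) fun x hx => ?_
  obtain ⟨hxs, hxK⟩ := hx
  refine hF0 x ?_
  by_contra h
  exact hxK (mem_closedBall_zero_iff.2 (norm_le_of_mem_zSlab_of_cylRadius_lt hL hxs (not_le.1 h)))

/-- **Vertical averaging on one period** (Tonelli): for a measurable `z`-independent weight
`g ≥ 0` and a continuous axially `L`-periodic density `f ≥ 0` (`L > 0`),
`∫⁻_{slab} g(x) (∫₀ᴸ f(x + s e₃) ds) dx = L ∫⁻_{slab} g f`: swap the integrals and use the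
invariance of slab integrals of periodic densities under axial translations
(`setLIntegral_zSlab_comp_add_smul_eZ`). -/
theorem setLIntegral_zSlab_mul_verticalIntegral {L : ℝ} (hL : 0 < L)
    {g : EuclideanSpace ℝ (Fin 3) → ℝ} (hgm : Measurable g) (hg0 : ∀ x, 0 ≤ g x)
    (hgz : ∀ (x : EuclideanSpace ℝ (Fin 3)) (s : ℝ), g (x + s • eZ) = g x)
    {f : EuclideanSpace ℝ (Fin 3) → ℝ} (hfc : Continuous f) (hf0 : ∀ x, 0 ≤ f x)
    (hfper : IsAxiallyPeriodic L f) :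
    ∫⁻ x in zSlab L 0, ENNReal.ofReal (g x * ∫ s in (0 : ℝ)..L, f (x + s • eZ)) =
      ENNReal.ofReal L * ∫⁻ x in zSlab L 0, ENNReal.ofReal (g x * f x) := by
  -- (a) the inner integral as a Lebesgue integral
  have hline : ∀ x : EuclideanSpace ℝ (Fin 3), Continuous fun s : ℝ => g x * f (x + s • eZ) :=
    fun x => continuous_const.mul (hfc.comp (continuous_const.add (continuous_id.smul continuous_const)))
  have ha : ∀ x : EuclideanSpace ℝ (Fin 3), ENNReal.ofReal (g x * ∫ s in (0 : ℝ)..L, f (x + s • eZ)) =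
      ∫⁻ s in Ioc 0 L, ENNReal.ofReal (g x * f (x + s • eZ)) := by
    intro x
    rw [intervalIntegral.integral_of_le hL.le, ← integral_const_mul]
    refine ofReal_integral_eq_lintegral_ofReal ?_ ?_
    · exact ((hline x).integrableOn_Icc).mono_set Ioc_subset_Icc_self
    · exact Eventually.of_forall fun s => mul_nonneg (hg0 x) (hf0 _)
  simp_rw [ha]
  -- (b) Tonelli
  have hΦm : AEMeasurable (uncurry fun (x : EuclideanSpace ℝ (Fin 3)) (s : ℝ) =>
      ENNReal.ofReal (g x * f (x + s • eZ)))
      ((volume.restrict (zSlab L 0)).prod (volume.restrict (Ioc 0 L))) := by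
    refine (ENNReal.measurable_ofReal.comp ?_).aemeasurable
    exact (hgm.comp measurable_fst).mul
      (hfc.measurable.comp (measurable_fst.add (measurable_snd.smul measurable_const)))
  rw [lintegral_lintegral_swap hΦm]
  -- (c) the inner slab integral does not depend on `s`
  set Q : EuclideanSpace ℝ (Fin 3) → ℝ≥0∞ := fun x => ENNReal.ofReal (g x * f x) with hQ
  have hQm : Measurable Q := ENNReal.measurable_ofReal.comp (hgm.mul hfc.measurable)
  have hQper : IsAxiallyPeriodic L Q := fun x => by
    simp only [hQ]
    rw [hfper x]
    have : g (x + L • EuclideanSpace.single 2 (1 : ℝ)) = g x := hgz x L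
    rw [this]
  have hinner : ∀ s : ℝ, ∫⁻ x in zSlab L 0, ENNReal.ofReal (g x * f (x + s • eZ)) =
      ∫⁻ x in zSlab L 0, Q x := by
    intro s
    rw [← setLIntegral_zSlab_comp_add_smul_eZ hL hQm hQper s]
    refine lintegral_congr fun x => ?_
    simp only [hQ, hgz x s]
  simp_rw [hinner]
  rw [setLIntegral_const, Real.volume_Ioc, sub_zero, mul_comm]

/-- **The Wirtinger inequality on one period slab, under a `z`-independent weight** (sharp
constant). Let `V ∈ C²(ℝ³; ℝ³)` be axially `L`-periodic (`L > 0`) and let `g ≥ 0` be a bounded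
measurable weight, independent of `x₃` and vanishing off a cylinder `{r < ρ}`. Then
`(2π/L)² ∫_{zSlab L 0} g ‖∂₃V‖² ≤ ∫_{zSlab L 0} g ‖∂₃∂₃V‖²` (`∂₃ = D(·) e₃`). This is the
inequality "`‖∂_{x_3}u √φ_R‖_{L²(Ω)} ≤ (1/2π)‖∂²_{x_3}u √φ_R‖_{L²(Ω)}`" of the printed proof
(Bang–Gui–Wang–Xie, §5 Step 4), for general period `L`. -/
theorem slab_wirtinger {L : ℝ} (hL : 0 < L)
    {V : EuclideanSpace ℝ (Fin 3) → EuclideanSpace ℝ (Fin 3)} (hV : ContDiff ℝ 2 V)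
    (hper : IsAxiallyPeriodic L V) {g : EuclideanSpace ℝ (Fin 3) → ℝ} (hgm : Measurable g)
    (hg0 : ∀ x, 0 ≤ g x) (hgz : ∀ (x : EuclideanSpace ℝ (Fin 3)) (s : ℝ), g (x + s • eZ) = g x)
    {G : ℝ} (hgG : ∀ x, g x ≤ G) {ρ : ℝ} (hgρ : ∀ x, ρ ≤ cylRadius x → g x = 0) :
    (2 * Real.pi / L) ^ 2 * ∫ x in zSlab L 0, g x * ‖fderiv ℝ V x eZ‖ ^ 2 ≤
      ∫ x in zSlab L 0, g x * ‖fderiv ℝ (fun y => fderiv ℝ V y eZ) x eZ‖ ^ 2 := by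
  set w : EuclideanSpace ℝ (Fin 3) → EuclideanSpace ℝ (Fin 3) := fun y => fderiv ℝ V y eZ with hw
  set dw : EuclideanSpace ℝ (Fin 3) → EuclideanSpace ℝ (Fin 3) := fun y => fderiv ℝ w y eZ with hdw
  have hw1 : ContDiff ℝ 1 w := (hV.fderiv_right (m := 1) le_rfl).clm_apply contDiff_const
  have hwc : Continuous w := hw1.continuous
  have hdwc : Continuous dw := (hw1.continuous_fderiv one_ne_zero).clm_apply continuous_const
  have hwper : IsAxiallyPeriodic L w := fun y => by
    show fderiv ℝ V (y + L • EuclideanSpace.single 2 1) eZ = fderiv ℝ V y eZ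
    rw [isAxiallyPeriodic_fderiv hper y]
  have hdwper : IsAxiallyPeriodic L dw := fun y => by
    show fderiv ℝ w (y + L • EuclideanSpace.single 2 1) eZ = fderiv ℝ w y eZ
    rw [isAxiallyPeriodic_fderiv hwper y]
  -- the two densities
  set f₁ : EuclideanSpace ℝ (Fin 3) → ℝ := fun x => ‖w x‖ ^ 2 with hf₁
  set f₂ : EuclideanSpace ℝ (Fin 3) → ℝ := fun x => ‖dw x‖ ^ 2 with hf₂
  have hf₁c : Continuous f₁ := hwc.norm.pow 2
  have hf₂c : Continuous f₂ := hdwc.norm.pow 2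
  have hf₁per : IsAxiallyPeriodic L f₁ := fun x => by simp only [hf₁]; rw [hwper x]
  have hf₂per : IsAxiallyPeriodic L f₂ := fun x => by simp only [hf₂]; rw [hdwper x]
  -- vertical averaging
  have key₁ := setLIntegral_zSlab_mul_verticalIntegral hL hgm hg0 hgz hf₁c (fun x => sq_nonneg _) hf₁per
  have key₂ := setLIntegral_zSlab_mul_verticalIntegral hL hgm hg0 hgz hf₂c (fun x => sq_nonneg _) hf₂per
  -- pointwise vertical Wirtinger
  have hAB : ∀ x : EuclideanSpace ℝ (Fin 3),
      (2 * Real.pi / L) ^ 2 * (g x * ∫ s in (0 : ℝ)..L, f₁ (x + s • eZ)) ≤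
        g x * ∫ s in (0 : ℝ)..L, f₂ (x + s • eZ) := by
    intro x
    have h := vertical_wirtinger hL hV hper x
    have hg := hg0 x
    calc (2 * Real.pi / L) ^ 2 * (g x * ∫ s in (0 : ℝ)..L, f₁ (x + s • eZ))
        = g x * ((2 * Real.pi / L) ^ 2 * ∫ s in (0 : ℝ)..L, ‖fderiv ℝ V (x + s • eZ) eZ‖ ^ 2) := by
          simp only [hf₁, hw]; ring
      _ ≤ g x * ∫ s in (0 : ℝ)..L, f₂ (x + s • eZ) := by
          simp only [hf₂, hdw, hw]
          exact mul_le_mul_of_nonneg_left h hg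
  -- the inequality between Lebesgue integrals
  set I₁ : ℝ≥0∞ := ∫⁻ x in zSlab L 0, ENNReal.ofReal (g x * f₁ x) with hI₁
  set I₂ : ℝ≥0∞ := ∫⁻ x in zSlab L 0, ENNReal.ofReal (g x * f₂ x) with hI₂
  have hc0 : 0 ≤ (2 * Real.pi / L) ^ 2 := sq_nonneg _
  have hle : ENNReal.ofReal ((2 * Real.pi / L) ^ 2) * (ENNReal.ofReal L * I₁) ≤
      ENNReal.ofReal L * I₂ := by
    rw [← key₁, ← key₂, ← lintegral_const_mul' _ _ ENNReal.ofReal_ne_top]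
    refine lintegral_mono fun x => ?_
    rw [← ENNReal.ofReal_mul hc0]
    exact ENNReal.ofReal_le_ofReal (hAB x)
  have hL0 : ENNReal.ofReal L ≠ 0 := by simpa using hL
  have hle' : ENNReal.ofReal ((2 * Real.pi / L) ^ 2) * I₁ ≤ I₂ := by
    rw [← mul_assoc, mul_comm (ENNReal.ofReal _) (ENNReal.ofReal L), mul_assoc] at hle
    exact (ENNReal.mul_le_mul_iff_right hL0 ENNReal.ofReal_ne_top).1 hle
  -- integrability of the two integrands on the slab
  obtain ⟨B₁, hB₁⟩ := (isCompact_closedBall (0 : EuclideanSpace ℝ (Fin 3)) (|ρ| + L)).exists_bound_of_continuousOn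
    hf₁c.continuousOn
  obtain ⟨B₂, hB₂⟩ := (isCompact_closedBall (0 : EuclideanSpace ℝ (Fin 3)) (|ρ| + L)).exists_bound_of_continuousOn
    hf₂c.continuousOn
  have hG0 : 0 ≤ G := (hg0 0).trans (hgG 0)
  have hF0 : ∀ (f : EuclideanSpace ℝ (Fin 3) → ℝ) (x : EuclideanSpace ℝ (Fin 3)),
      ρ ≤ cylRadius x → g x * f x = 0 := fun f x hx => by rw [hgρ x hx, zero_mul]
  have hFB : ∀ (f : EuclideanSpace ℝ (Fin 3) → ℝ) (B : ℝ),
      (∀ x ∈ Metric.closedBall (0 : EuclideanSpace ℝ (Fin 3)) (|ρ| + L), ‖f x‖ ≤ B) →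
      ∀ x : EuclideanSpace ℝ (Fin 3), ‖x‖ ≤ |ρ| + L → ‖g x * f x‖ ≤ G * B := by
    intro f B hB x hx
    rw [norm_mul, Real.norm_of_nonneg (hg0 x)]
    exact mul_le_mul (hgG x) (hB x (mem_closedBall_zero_iff.2 hx)) (norm_nonneg _) hG0
  have hm₁ : AEStronglyMeasurable (fun x => g x * f₁ x) volume :=
    (hgm.mul hf₁c.measurable).aestronglyMeasurable
  have hm₂ : AEStronglyMeasurable (fun x => g x * f₂ x) volume :=
    (hgm.mul hf₂c.measurable).aestronglyMeasurable
  have hint₁ : IntegrableOn (fun x => g x * f₁ x) (zSlab L 0) volume :=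
    integrableOn_zSlab_of_bound hL hm₁ (hF0 f₁) (hFB f₁ B₁ hB₁)
  have hint₂ : IntegrableOn (fun x => g x * f₂ x) (zSlab L 0) volume :=
    integrableOn_zSlab_of_bound hL hm₂ (hF0 f₂) (hFB f₂ B₂ hB₂)
  -- back to Bochner integrals
  have hnn₁ : 0 ≤ᵐ[volume.restrict (zSlab L 0)] fun x => g x * f₁ x :=
    Eventually.of_forall fun x => mul_nonneg (hg0 x) (sq_nonneg _)
  have hnn₂ : 0 ≤ᵐ[volume.restrict (zSlab L 0)] fun x => g x * f₂ x :=
    Eventually.of_forall fun x => mul_nonneg (hg0 x) (sq_nonneg _)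
  have e₁ : ∫ x in zSlab L 0, g x * ‖fderiv ℝ V x eZ‖ ^ 2 = I₁.toReal :=
    integral_eq_lintegral_of_nonneg_ae hnn₁ hm₁.restrict
  have e₂ : ∫ x in zSlab L 0, g x * ‖fderiv ℝ (fun y => fderiv ℝ V y eZ) x eZ‖ ^ 2 = I₂.toReal :=
    integral_eq_lintegral_of_nonneg_ae hnn₂ hm₂.restrict
  have hI₂fin : I₂ ≠ ⊤ := by
    have h := hint₂.2
    rw [hasFiniteIntegral_iff_enorm] at h
    exact (lt_of_le_of_lt (lintegral_ofReal_le_lintegral_enorm _) h).ne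
  rw [e₁, e₂, ← ENNReal.toReal_ofReal hc0, ← ENNReal.toReal_mul]
  exact ENNReal.toReal_mono hI₂fin hle'

end Summit.NavierStokesRegularity.NavierStokesRegularity.Theorems.ScenarioCensus.PeriodicSlab

end
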